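import Literature.NumberTheory.Automorphic.ShimuraCurveRibetTakahashiFreyManinProofs
import Literature.NumberTheory.Automorphic.ShimuraCurveRibetTakahashiProofs
import Literature.NumberTheory.EllipticCurves.CuspFormLFunctionLevelConductorProofs
import Literature.NumberTheory.EllipticCurves.NewformPeterssonSizeSymmSquareProofs
import Literature.NumberTheory.EllipticCurves.ManinConstantSemistablePrimewise
import HarnessLib

/-!
# The semistable row of Pasten's Cor. 10.2 (`S = ∅`), discharged modulo the classical semistable
# Manin-constant theorem, and Carayol's level theorem at square-free LEVELS

Topic `NumberTheory/Automorphic`; a proofs-only companion (theorems only, no new named fact) of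
`Literature.NumberTheory.Automorphic.PastenShimura2024_cor_10_2` (H. Pasten, *Shimura curves and
the abc conjecture*, arXiv:1705.09251 = J. Number Theory 254 (2024), Cor. 10.2 p. 33 = Thm. 1.3
p. 4), written by the seat of that fact.

The fact is a conjunction of ROWS indexed by the finite set `S` of primes at which additive
reduction is allowed:

  `Row S` :≡ `∃ 𝓜, ∀ N W Dt, (∀ p prime, p ∉ S → p² ∤ N) → (Dt of minimal degree) → |Dt.c| ≤ 𝓜`,

`PastenShimura2024_cor_10_2 = ∀ S, Row S` (by `rfl`). The rows decrease in strength as `S`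
shrinks (`PastenShimura2024_cor_10_2_row_anti`), and the printed proof (p. 33: "an immediate
consequence of the previous theorem [Thm. 10.1] and the known results about the Manin constant at
primes with `v_p(N) ≤ 1`") needs Pasten's new Thm. 10.1 exactly at the primes of `S`
(`ShimuraCurveRibetTakahashiProofs`: `PastenShimura2024_cor_10_2_iff_thm_10_1_latticeForm_of_mazur`).
**The row `S = ∅` needs no new input at all**: at a square-free level the curve carrying a datum
is semistable and the "known results" are Česnavičius's theorem `c = ±1` (Česnavičius 2018,
Thm. 1.2), the tree's named fact
`ModularParametrizationData.abs_maninConstant_eq_one_of_isSemistable` (itself assembled in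
`ManinConstantSemistablePrimewise` from Mazur 1978 Cor. 4.1, Abbes–Ullmo 1996 Thm. A and
Česnavičius's new case `2 ∥ N`). This file proves that row from that fact (and from the prime-wise
trio), and threads it to the downstream theorems of `ShimuraCurveRibetTakahashiFreyManinProofs`,
so that consumers on the SEMISTABLE family (the `abc` routes' re-cut crux
`ManyPrimeValuationProductSemistableFrey`, whose stub `jlPackageSF_of_facts` uses the fact only
through `hManin {2}` at a square-free level) can be fed by the classical fact instead of Pasten's
`XL` one.

## Main statements

* `IsNewformOf.squarefree_conductorNorm_of_squarefree_level`,
  `IsNewformOf.level_eq_conductorNorm_of_squarefree_level`,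
  `IsNewformOf.isSemistable_of_squarefree_level`, `IsNewformOf.squarefree_level_iff_isSemistable` —
  **Carayol's theorem `N = N_E` at square-free LEVELS, proved**: if `f ∈ S₂(Γ₀(N))` is the newform
  of an elliptic `W/ℚ` (`IsNewformOf W f`) and the level `N` is squarefree, then the conductor
  `N_W` is squarefree, `N = N_W`, and `W` is semistable. (The tree had the case "`N_W` squarefree",
  `IsNewformOf.level_eq_conductorNorm_of_squarefree`; here the hypothesis is on the level, which is
  what a parametrisation datum `ModularParametrizationData W N` carries.) Proof by `q`-expansions:
  `p² ∣ N_W` would make `p` additive for `W` (Silverman ATAEC IV.10.2 (c),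
  `two_le_conductorExponent_iff_holds`), so `a_p(W) = 0` (local factor `1`), while `p ∣ N_W` gives
  `p ∣ N` (`IsNewformOf.dvd_level_iff_dvd_conductorNorm`), `p ∥ N`, and `a_p(f)² = 1`
  (Atkin–Lehner 1970, Thm. 3; `IsNewform0.cuspCoeff_sq_eq_one_of_dvd_of_not_sq_dvd`).
* `PastenShimura2024_cor_10_2_row_anti` — `Row T → Row S` for `S ⊆ T`; `PastenShimura2024_cor_10_2.row`.
* `abs_maninConstant_eq_one_of_squarefree_level` — from the semistable fact (`hC1`, quantified over
  all data as the `abc` routes quantify it): a minimal-degree datum on a globally minimal curve at a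
  square-free LEVEL has `|c| = 1`.
* `PastenShimura2024_cor_10_2_row_empty_of_abs_maninConstant_eq_one_of_isSemistable` — **the row
  `S = ∅` of Cor. 10.2 from Česnavičius's theorem** (`𝓜_∅ = 1`);
  `PastenShimura2024_cor_10_2_row_empty_of_primewise` — the same from the three prime-by-prime facts
  (Mazur, Abbes–Ullmo, Česnavičius) through `abs_maninConstant_eq_one_of_isSemistable_holds_of`.
* `exists_datum_maninConstant_le_of_row` — the engine of
  `PastenShimura2024_cor_10_2.exists_datum_maninConstant_le` run on ONE row: `Row S`, the optimal
  quotient (`exists_optimal_modularParametrizationData`), Mazur–Kenku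
  (`mazurKenku_exists_cyclic_isogeny`) and the Néron mapping property
  (`integral_neronScaling_of_isGloballyMinimal`) give every globally minimal curve with conductor
  square-free away from `S` a datum at its conductor with `|c| ≤ 163 · 𝓜_S`;
  `exists_datum_maninConstant_le_of_isSemistable_of_abs_maninConstant_eq_one` — hence, on the
  semistable family, the bounded-Manin-constant input `hM` of the `abc` routes
  (`semistableDegreeConjecture_of_abc_of_boundedManin`) from the CLASSICAL semistable fact, with
  `M = 163`.
* `PastenShimura2024_cor_10_2_row_iff_latticeRow` — each row is its own lattice ("optimal curve")
  form (row-wise `PastenShimura2024_cor_10_2_iff_latticeForm`).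
* `PastenShimura2024_cor_10_2_row_of_thm_10_1_at_of_mazur`, `PastenShimura2024_cor_10_2_thm_10_1_at_of_row`,
  `PastenShimura2024_cor_10_2_row_iff_thm_10_1_at_of_mazur` — **row by row, modulo Mazur's Cor. 4.1
  the row at `S` is exactly Pasten's Thm. 10.1 at the primes of `S ∪ {2}`** (in lattice form, for
  optimal curves at levels square-free away from `S`); the printed deduction p. 33 one row at a
  time (the global statements are `PastenShimura2024_cor_10_2_of_thm_10_1_of_mazur` and
  `PastenShimura2024_cor_10_2_iff_thm_10_1_latticeForm_of_mazur` of `ShimuraCurveRibetTakahashiProofs`).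
* `PastenShimura2024_cor_10_2_row_two_iff_of_mazur` — **the row `S = {2}`, the one the `abc`
  routes use (`hManin {2}` in `jlPackage_printedClass_of_facts` and `stub_twoPrimePackage`), is,
  modulo Mazur's Cor. 4.1, exactly the single case `p = 2` of Pasten's Thm. 10.1 at `S = {2}`**:
  a uniform bound for `v₂(c_f)` over the optimal curves semistable away from `2` — Pasten's
  genuinely new content (Thm. 10.3 at `p = 2`, `2 ≤ n ≤ 8`), for which no classical substitute
  exists (Česnavičius 2018 covers `v₂(N) ≤ 1` only).

## References

* H. Pasten, *Shimura curves and the abc conjecture*, arXiv:1705.09251, Thm. 1.3 p. 4, Cor. 10.2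
  p. 33, §3 p. 13. [PastenShimura2024]
* K. Česnavičius, *The Manin constant in the semistable case*, Compositio Math. 154 (2018),
  Thm. 1.2. [Cesnavicius2018]
* A. O. L. Atkin, J. Lehner, *Hecke operators on `Γ₀(m)`*, Math. Ann. 185 (1970), Thm. 3.
  [AtkinLehner1970]
* F. Diamond, J. Shurman, *A first course in modular forms*, GTM 228, Thm. 8.8.1 (Carayol's level
  theorem). [DiamondShurman2005]
* J. H. Silverman, *Advanced topics in the arithmetic of elliptic curves*, GTM 151, IV.10.2.
  [Silverman1994]
-/

noncomputable section

open scoped MatrixGroups ModularForm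

open CongruenceSubgroup UpperHalfPlane IsDedekindDomain NumberField Rat.HeightOneSpectrum

namespace Literature.NumberTheory.Automorphic

open Literature.NumberTheory.EllipticCurves.ModularForms
open Literature.NumberTheory.EllipticCurves _root_.WeierstrassCurve

/-! ### Carayol's level theorem at square-free levels -/

section Level

variable {N : ℕ} [NeZero N] {W : WeierstrassCurve ℚ} [W.IsElliptic] {f : CuspForm (Gamma0 N) 2}

/-- **A curve whose newform has square-free level is semistable: `N` squarefree `⇒ N_W`
squarefree.** For an elliptic `W/ℚ`, its newform `f ∈ S₂(Γ₀(N))` (`IsNewformOf W f`) and `N`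
squarefree: were `p² ∣ N_W`, the place over `p` would be additive for `W` (`f_p ≥ 2`, Silverman
ATAEC IV.10.2 (c): `two_le_conductorExponent_iff_holds`, `factorization_conductorNorm_holds`),
forcing `a_p(W) = 0` (`LFunction_apply_primesEquiv_of_hasAdditiveReductionAt`); but `p ∣ N_W`
gives `p ∣ N` (`IsNewformOf.dvd_level_iff_dvd_conductorNorm`), so `p ∥ N` and `a_p(f)² = 1`
(Atkin–Lehner 1970, Thm. 3; `IsNewform0.cuspCoeff_sq_eq_one_of_dvd_of_not_sq_dvd`), while
`a_p(f) = a_p(W)`. (A dot-notation extension of `IsNewformOf`, which lives in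
`EllipticCurves/CuspFormLFunction.lean`, declared by its absolute name.)
[cite: AtkinLehner1970, Thm. 3] [cite: Silverman1994, IV.10.2(c)] -/
theorem _root_.Literature.NumberTheory.EllipticCurves.ModularForms.IsNewformOf.squarefree_conductorNorm_of_squarefree_level
    (hf : IsNewformOf W f) (hsq : Squarefree N) : Squarefree (W.conductorNorm ℤ) := by
  rw [Nat.squarefree_iff_prime_squarefree]
  intro p hp hp2
  -- `p ∣ N_W`, hence `p ∣ N`, and `p² ∤ N`
  have hpW : p ∣ W.conductorNorm ℤ := dvd_trans (dvd_mul_right p p) hp2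
  have hpN : p ∣ N := (hf.dvd_level_iff_dvd_conductorNorm hp).mpr hpW
  have hp2N : ¬ p ^ 2 ∣ N := fun h ↦
    (Nat.squarefree_iff_prime_squarefree.mp hsq) p hp (by rwa [sq] at h)
  -- `a_p(f)² = 1`
  have h1 : cuspCoeff f p ^ 2 = 1 := hf.1.cuspCoeff_sq_eq_one_of_dvd_of_not_sq_dvd hp hpN hp2N
  -- the place of `ℤ` over `p` is additive for `W`
  set v : HeightOneSpectrum ℤ := (primesEquiv (R := ℤ)).symm ⟨p, hp⟩ with hv
  have hgen : natGenerator v = p :=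
    congrArg (fun q : Nat.Primes ↦ (q : ℕ)) ((primesEquiv (R := ℤ)).apply_symm_apply ⟨p, hp⟩)
  have hadd : W.HasAdditiveReductionAt v := by
    refine (W.two_le_conductorExponent_iff_holds v).mp ?_
    rw [← W.factorization_conductorNorm_holds v, hgen]
    exact (hp.pow_dvd_iff_le_factorization (W.conductorNorm_pos_holds).ne').mp (by rwa [sq])
  have hadd' : W.HasAdditiveReductionAt ((primesEquiv (R := 𝓞 ℚ)).symm ⟨p, hp⟩) :=
    (W.hasAdditiveReductionAt_int_iff_ringOfIntegers ⟨p, hp⟩).mp hadd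
  -- so `a_p(W) = 0 = a_p(f)`, contradicting `a_p(f)² = 1`
  have h0 := W.LFunction_apply_primesEquiv_of_hasAdditiveReductionAt hadd'
  rw [Equiv.apply_symm_apply] at h0
  have h0' : cuspCoeff f p = 0 := by
    rw [hf.2 p]
    exact_mod_cast h0
  rw [h0'] at h1
  norm_num at h1

/-- **Carayol's level theorem at a square-free level: `N = N_W`.** For an elliptic `W/ℚ` and its
newform `f ∈ S₂(Γ₀(N))` with `N` squarefree, the level is the conductor
(`IsNewformOf.level_eq_conductorNorm_of_squarefree`, the tree's proof for squarefree CONDUCTOR, fed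
by `IsNewformOf.squarefree_conductorNorm_of_squarefree_level`). This is the square-free-level case
of the named fact `IsNewformOf.level_eq_conductorNorm` (Carayol 1986; Diamond–Shurman Thm. 8.8.1),
by `q`-expansion arithmetic alone. [cite: DiamondShurman2005, Thm. 8.8.1] [cite: AtkinLehner1970, Thm. 3] -/
theorem _root_.Literature.NumberTheory.EllipticCurves.ModularForms.IsNewformOf.level_eq_conductorNorm_of_squarefree_level
    (hf : IsNewformOf W f) (hsq : Squarefree N) : N = W.conductorNorm ℤ :=
  hf.level_eq_conductorNorm_of_squarefree (hf.squarefree_conductorNorm_of_squarefree_level hsq)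

/-- **A curve with a newform of square-free level is semistable** (`N_W` is squarefree,
`IsNewformOf.squarefree_conductorNorm_of_squarefree_level`, which for a curve over `ℚ` is
semistability: `f_v ≤ 1` at every place, Silverman ATAEC IV.10.2,
`WeierstrassCurve.isSemistable_iff_squarefree_conductorNorm`). [cite: Silverman1994, IV.10.2] -/
theorem _root_.Literature.NumberTheory.EllipticCurves.ModularForms.IsNewformOf.isSemistable_of_squarefree_level
    (hf : IsNewformOf W f) (hsq : Squarefree N) : W.IsSemistable ℤ :=
  (W.isSemistable_iff_squarefree_conductorNorm).mpr (hf.squarefree_conductorNorm_of_squarefree_level hsq)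

/-- **For the newform `f ∈ S₂(Γ₀(N))` of `W`: the level `N` is squarefree iff `W` is semistable**
(`⇒`: `IsNewformOf.isSemistable_of_squarefree_level`; `⇐`: a semistable curve has squarefree
conductor, and then `N = N_W` by the tree's `IsNewformOf.level_eq_conductorNorm_of_squarefree`).
[cite: DiamondShurman2005, Thm. 8.8.1] [cite: Silverman1994, IV.10.2] -/
theorem _root_.Literature.NumberTheory.EllipticCurves.ModularForms.IsNewformOf.squarefree_level_iff_isSemistable
    (hf : IsNewformOf W f) : Squarefree N ↔ W.IsSemistable ℤ := by
  refine ⟨hf.isSemistable_of_squarefree_level, fun hss ↦ ?_⟩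
  have hsq : Squarefree (W.conductorNorm ℤ) := (W.isSemistable_iff_squarefree_conductorNorm).mp hss
  rwa [hf.level_eq_conductorNorm_of_squarefree hsq]

/-- `N` is squarefree iff `p² ∤ N` for every prime `p` — the form in which the rows of
`PastenShimura2024_cor_10_2` state "squarefree away from `S`" at `S = ∅`. [folklore] -/
theorem squarefree_iff_forall_prime_not_sq_dvd {n : ℕ} :
    Squarefree n ↔ ∀ p : ℕ, p.Prime → ¬ p ^ 2 ∣ n := by
  rw [Nat.squarefree_iff_prime_squarefree]
  exact forall₂_congr fun p _ ↦ by rw [sq]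

end Level

/-! ### The rows of Cor. 10.2 -/

section Rows

/-- **The rows of Cor. 10.2 weaken as `S` shrinks**: for `S ⊆ T`, the row at `T` (a bound for all
optimal data at levels square-free away from `T`) implies the row at `S` (levels square-free away
from `S` are square-free away from `T`), with the same constant. In particular every row follows
from the fact, and the row `S = ∅` (square-free levels: the semistable optimal curves) is the
weakest. [cite: PastenShimura2024, Cor. 10.2 p. 33] -/
theorem PastenShimura2024_cor_10_2_row_anti {S T : Finset ℕ} (hST : S ⊆ T)
    (hT : ∃ 𝓜 : ℕ, ∀ (N : ℕ) [NeZero N] (W : WeierstrassCurve ℚ) [W.IsElliptic]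
      [W.IsGloballyMinimal] (Dt : ModularParametrizationData W N),
      (∀ p : ℕ, p.Prime → p ∉ T → ¬ p ^ 2 ∣ N) →
      (∀ (W' : WeierstrassCurve ℚ) [W'.IsElliptic] (D' : ModularParametrizationData W' N),
          D'.f = Dt.f → Dt.modularDegree ≤ D'.modularDegree) →
        |Dt.maninConstant| ≤ 𝓜) :
    ∃ 𝓜 : ℕ, ∀ (N : ℕ) [NeZero N] (W : WeierstrassCurve ℚ) [W.IsElliptic]
      [W.IsGloballyMinimal] (Dt : ModularParametrizationData W N),
      (∀ p : ℕ, p.Prime → p ∉ S → ¬ p ^ 2 ∣ N) →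
      (∀ (W' : WeierstrassCurve ℚ) [W'.IsElliptic] (D' : ModularParametrizationData W' N),
          D'.f = Dt.f → Dt.modularDegree ≤ D'.modularDegree) →
        |Dt.maninConstant| ≤ 𝓜 := by
  obtain ⟨𝓜, h𝓜⟩ := hT
  exact ⟨𝓜, fun N _ W _ _ Dt hS hmin ↦ h𝓜 N W Dt (fun p hp hpT ↦ hS p hp fun h ↦ hpT (hST h)) hmin⟩

/-- **Every row of Cor. 10.2 is a specialisation of the fact** (`PastenShimura2024_cor_10_2 = ∀ S, Row S`
definitionally; recorded for reference by name). [cite: PastenShimura2024, Cor. 10.2 p. 33] -/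
theorem PastenShimura2024_cor_10_2.row (h102 : PastenShimura2024_cor_10_2) (S : Finset ℕ) :
    ∃ 𝓜 : ℕ, ∀ (N : ℕ) [NeZero N] (W : WeierstrassCurve ℚ) [W.IsElliptic]
      [W.IsGloballyMinimal] (Dt : ModularParametrizationData W N),
      (∀ p : ℕ, p.Prime → p ∉ S → ¬ p ^ 2 ∣ N) →
      (∀ (W' : WeierstrassCurve ℚ) [W'.IsElliptic] (D' : ModularParametrizationData W' N),
          D'.f = Dt.f → Dt.modularDegree ≤ D'.modularDegree) →
        |Dt.maninConstant| ≤ 𝓜 :=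
  h102 S

/-- **`|c| = 1` for a minimal-degree datum at a square-free LEVEL, from the semistable fact.**
Input (`hC1`): the named fact `ModularParametrizationData.abs_maninConstant_eq_one_of_isSemistable`
at every datum (Česnavičius 2018, Thm. 1.2: `c = ±1` for the optimal parametrisation of a
semistable curve; quantified over all levels and data exactly as the `abc` routes quantify it,
e.g. `semistableDegreeConjecture_of_abc_of_facts`). For a globally minimal elliptic `W/ℚ`, a datum
`Dt` at a square-free level `N` of minimal degree among all data with its newform: `W` is
semistable (`IsNewformOf.isSemistable_of_squarefree_level`, from `Dt.isNewformOf`), so `hC1`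
applies. [cite: Cesnavicius2018, Thm. 1.2] [cite: AtkinLehner1970, Thm. 3] -/
theorem abs_maninConstant_eq_one_of_squarefree_level
    (hC1 : ∀ {N : ℕ} [NeZero N] {W : WeierstrassCurve ℚ} (D : ModularParametrizationData W N),
      D.abs_maninConstant_eq_one_of_isSemistable)
    {N : ℕ} [NeZero N] {W : WeierstrassCurve ℚ} [W.IsElliptic] [W.IsGloballyMinimal]
    (Dt : ModularParametrizationData W N) (hsq : Squarefree N)
    (hmin : ∀ (W' : WeierstrassCurve ℚ) [W'.IsElliptic] (D' : ModularParametrizationData W' N),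
      D'.f = Dt.f → Dt.modularDegree ≤ D'.modularDegree) :
    |Dt.maninConstant| = 1 :=
  hC1 Dt (Dt.isNewformOf.isSemistable_of_squarefree_level hsq) hmin

/-- **Pasten 2024, Cor. 10.2 — the row `S = ∅` (square-free levels), from Česnavičius's theorem.**
"There is a constant `𝓜_∅` such that for every optimal elliptic curve over `ℚ` with semistable
reduction (everywhere) and newform `f ∈ S₂(N)`, `c_f ≤ 𝓜_∅`": in the tree's rendering of the
fact, for every globally minimal `W`, every datum `Dt` at a level `N` with `p² ∤ N` for all primes
`p` (the fact's hypothesis at `S = ∅`) and of minimal degree among all data with its newform,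
`|Dt.c| ≤ 𝓜_∅`, with `𝓜_∅ = 1` — by `abs_maninConstant_eq_one_of_squarefree_level` from the named
fact `abs_maninConstant_eq_one_of_isSemistable` (`hC1`; Česnavičius 2018, Thm. 1.2). This is the
one row of the printed deduction (p. 33: "the known results about the Manin constant at primes
with `v_p(N) ≤ 1`") in which Pasten's Thm. 10.1 is not invoked; every other row needs it
(`PastenShimura2024_cor_10_2_iff_thm_10_1_latticeForm_of_mazur`).
[cite: PastenShimura2024, Cor. 10.2 p. 33 (= Thm. 1.3 p. 4)] [cite: Cesnavicius2018, Thm. 1.2] -/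
theorem PastenShimura2024_cor_10_2_row_empty_of_abs_maninConstant_eq_one_of_isSemistable
    (hC1 : ∀ {N : ℕ} [NeZero N] {W : WeierstrassCurve ℚ} (D : ModularParametrizationData W N),
      D.abs_maninConstant_eq_one_of_isSemistable) :
    ∃ 𝓜 : ℕ, ∀ (N : ℕ) [NeZero N] (W : WeierstrassCurve ℚ) [W.IsElliptic]
      [W.IsGloballyMinimal] (Dt : ModularParametrizationData W N),
      (∀ p : ℕ, p.Prime → p ∉ (∅ : Finset ℕ) → ¬ p ^ 2 ∣ N) →
      (∀ (W' : WeierstrassCurve ℚ) [W'.IsElliptic] (D' : ModularParametrizationData W' N),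
          D'.f = Dt.f → Dt.modularDegree ≤ D'.modularDegree) →
        |Dt.maninConstant| ≤ 𝓜 := by
  refine ⟨1, fun N _ W _ _ Dt hsq hmin ↦ ?_⟩
  have hsqN : Squarefree N :=
    squarefree_iff_forall_prime_not_sq_dvd.mpr fun p hp ↦ hsq p hp (Finset.notMem_empty p)
  rw [abs_maninConstant_eq_one_of_squarefree_level hC1 Dt hsqN hmin, Nat.cast_one]

/-- **The row `S = ∅` of Cor. 10.2 from the three prime-by-prime facts** — Mazur 1978 Cor. 4.1
(`mazur_not_dvd_maninConstant_of_odd`), Abbes–Ullmo 1996 Thm. A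
(`abbesUllmo_not_dvd_maninConstant_of_not_dvd_level`) and Česnavičius's case `2 ∥ N`
(`cesnavicius_not_two_dvd_maninConstant_of_two_dvd_level`) — which assemble the semistable fact
(`abs_maninConstant_eq_one_of_isSemistable_holds_of`, `ManinConstantSemistablePrimewise`). The
first of them is also the hypothesis `hM` of the fact's two-input glue
`PastenShimura2024_cor_10_2_holds_of`. [cite: PastenShimura2024, Cor. 10.2 p. 33]
[cite: Mazur1978, Cor. 4.1] [cite: AbbesUllmo1996, Thm. A] [cite: Cesnavicius2018, Thm. 1.2] -/
theorem PastenShimura2024_cor_10_2_row_empty_of_primewise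
    (hM : mazur_not_dvd_maninConstant_of_odd)
    (hAU : abbesUllmo_not_dvd_maninConstant_of_not_dvd_level)
    (hC : cesnavicius_not_two_dvd_maninConstant_of_two_dvd_level) :
    ∃ 𝓜 : ℕ, ∀ (N : ℕ) [NeZero N] (W : WeierstrassCurve ℚ) [W.IsElliptic]
      [W.IsGloballyMinimal] (Dt : ModularParametrizationData W N),
      (∀ p : ℕ, p.Prime → p ∉ (∅ : Finset ℕ) → ¬ p ^ 2 ∣ N) →
      (∀ (W' : WeierstrassCurve ℚ) [W'.IsElliptic] (D' : ModularParametrizationData W' N),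
          D'.f = Dt.f → Dt.modularDegree ≤ D'.modularDegree) →
        |Dt.maninConstant| ≤ 𝓜 :=
  PastenShimura2024_cor_10_2_row_empty_of_abs_maninConstant_eq_one_of_isSemistable
    fun D ↦ D.abs_maninConstant_eq_one_of_isSemistable_holds_of hM hAU hC

/-- **The bound in the shape the `abc` routes consume it** (`jlPackage_printedClass_of_facts`
reads the fact as `hManin N W₀ D₀ hsq hD₀min : |D₀.c| ≤ 𝓜` for the optimal datum `D₀` at the
conductor `N` of a curve with `p² ∤ N` at the relevant primes): on the semistable family, for every
level `N` with `p² ∤ N` for all primes `p`, every globally minimal `W₀` and every minimal-degree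
datum `D₀` at level `N`, `|D₀.c| ≤ 1`, from the semistable fact `hC1` alone.
[cite: Cesnavicius2018, Thm. 1.2] [cite: PastenShimura2024, Cor. 10.2 p. 33] -/
theorem abs_maninConstant_le_one_of_forall_prime_not_sq_dvd
    (hC1 : ∀ {N : ℕ} [NeZero N] {W : WeierstrassCurve ℚ} (D : ModularParametrizationData W N),
      D.abs_maninConstant_eq_one_of_isSemistable)
    (N : ℕ) [NeZero N] (W₀ : WeierstrassCurve ℚ) [W₀.IsElliptic] [W₀.IsGloballyMinimal]
    (D₀ : ModularParametrizationData W₀ N) (hsq : ∀ p : ℕ, p.Prime → ¬ p ^ 2 ∣ N)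
    (hmin : ∀ (W' : WeierstrassCurve ℚ) [W'.IsElliptic] (D' : ModularParametrizationData W' N),
      D'.f = D₀.f → D₀.modularDegree ≤ D'.modularDegree) :
    |D₀.maninConstant| ≤ 1 :=
  (abs_maninConstant_eq_one_of_squarefree_level hC1 D₀
    (squarefree_iff_forall_prime_not_sq_dvd.mpr hsq) hmin).le

end Rows

/-! ### Downstream: one row at a time -/

section Downstream

/-- **One row of Cor. 10.2 transported along isogenies** — the engine of
`PastenShimura2024_cor_10_2.exists_datum_maninConstant_le` run on the single row it uses: given
the row at `S` (`hrow`, constant `𝓜`), the optimal quotient on a globally minimal model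
(`exists_optimal_modularParametrizationData`), Mazur–Kenku (`mazurKenku_exists_cyclic_isogeny`) and
the Néron mapping property (`integral_neronScaling_of_isGloballyMinimal`), every GLOBALLY MINIMAL
elliptic `W/ℚ` whose conductor `N` is square-free away from `S` has a datum at level `N` with
`|c| ≤ 163 · 𝓜`: the optimal `W₀ ~ W` carries the minimal-degree datum `D₀` with the newform `f`
of `W` and `|c₀| ≤ 𝓜` (the row); an integral multiplier `k₁`, `|k₁| ≤ 163`, takes `Λ_{W₀}` into
the Néron lattice `Λ_W` (`exists_int_mul_mem_lattice_natAbs_le_163`); `(f, Λ_W, k₁ c₀)` is a datum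
of `W` (`ModularParametrizationData.exists_of_isNewformOf`). Pasten §3 p. 13: "The degree of a
minimal isogeny between `A_{1,N}` and `E` is uniformly bounded by `163` thanks to Mazur and Kenku".
[cite: PastenShimura2024, §3 p. 13 and Cor. 10.2 p. 33] [cite: SilvermanAEC2009, IX.6 Example 6.4] -/
theorem exists_datum_maninConstant_le_of_row (S : Finset ℕ)
    (hrow : ∃ 𝓜 : ℕ, ∀ (N : ℕ) [NeZero N] (W : WeierstrassCurve ℚ) [W.IsElliptic]
      [W.IsGloballyMinimal] (Dt : ModularParametrizationData W N),
      (∀ p : ℕ, p.Prime → p ∉ S → ¬ p ^ 2 ∣ N) →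
      (∀ (W' : WeierstrassCurve ℚ) [W'.IsElliptic] (D' : ModularParametrizationData W' N),
          D'.f = Dt.f → Dt.modularDegree ≤ D'.modularDegree) →
        |Dt.maninConstant| ≤ 𝓜)
    (hopt : exists_optimal_modularParametrizationData)
    (hMK : mazurKenku_exists_cyclic_isogeny) (hNS : integral_neronScaling_of_isGloballyMinimal) :
    ∃ M : ℕ, ∀ (W : WeierstrassCurve ℚ) [W.IsElliptic] [W.IsGloballyMinimal] (N : ℕ) [NeZero N],
      W.conductorNorm ℤ = N → (∀ p : ℕ, p.Prime → p ∉ S → ¬ p ^ 2 ∣ N) →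
        ∃ D : ModularParametrizationData W N, D.maninConstant.natAbs ≤ M := by
  obtain ⟨𝓜, h𝓜⟩ := hrow
  refine ⟨163 * 𝓜, fun W _ _ N _ hN hsq ↦ ?_⟩
  haveI : (W.baseChange ℂ).IsElliptic := by rw [WeierstrassCurve.baseChange]; infer_instance
  -- the optimal curve `W₀ ~ W` and its datum `D₀` of minimal degree; the row's bound `|c₀| ≤ 𝓜`
  obtain ⟨W₀, hW₀, hW₀min, D₀, hfW, hisoW, hmin⟩ := hopt N W hN
  haveI := hW₀
  haveI := hW₀min
  have hc𝓜 : |D₀.maninConstant| ≤ (𝓜 : ℤ) := h𝓜 N W₀ D₀ hsq hmin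
  have hc₀ : D₀.c.natAbs ≤ 𝓜 := by
    have h1 : ((D₀.c.natAbs : ℕ) : ℤ) ≤ 𝓜 := by rw [Int.natCast_natAbs]; exact hc𝓜
    exact_mod_cast h1
  -- a bounded integral multiplier `Λ_{W₀} → Λ_W` (Mazur–Kenku with the Néron mapping property)
  obtain ⟨LW, hLW⟩ := exists_isNeronLatticeOf_holds (W.baseChange ℂ)
  obtain ⟨k, hk0, hk163, hk⟩ := exists_int_mul_mem_lattice_natAbs_le_163 hMK hNS
    hisoW.symm_of_charZero D₀.isNeronLattice hLW
  -- the multiplier `k c₀` takes `Λ_f` into `Λ_W`; the datum `(f, Λ_W, k c₀)`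
  have hm0 : k * D₀.c ≠ 0 := mul_ne_zero hk0 D₀.maninConstant_ne_zero_holds
  have hle : ∀ z ∈ periodLattice D₀.f, ((k * D₀.c : ℤ) : ℂ) * z ∈ LW.lattice := fun z hz ↦ by
    have h2 := hk _ (D₀.smul_periodLattice_le z hz)
    rwa [← mul_assoc, ← Int.cast_mul] at h2
  obtain ⟨D, -, -, hDc⟩ := ModularParametrizationData.exists_of_isNewformOf hfW hLW hm0 hle
  refine ⟨D, ?_⟩
  show D.c.natAbs ≤ 163 * 𝓜
  rw [hDc, Int.natAbs_mul]
  exact Nat.mul_le_mul hk163 hc₀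

/-- **The semistable family from the CLASSICAL fact: every globally minimal semistable elliptic
curve over `ℚ` has a datum at the level of its conductor with `|c| ≤ 163`** — the hypothesis
`hM` of the `abc` routes' `semistableDegreeConjecture_of_abc_of_boundedManin` / `stub_ofAbc`,
here from Česnavičius's semistable theorem (`hC1`, the named fact
`abs_maninConstant_eq_one_of_isSemistable`, giving the row `S = ∅` with `𝓜_∅ = 1`), the optimal
quotient, Mazur–Kenku and the Néron mapping property (`exists_datum_maninConstant_le_of_row` at
`S = ∅`; a semistable curve has square-free conductor,
`WeierstrassCurve.isSemistable_iff_squarefree_conductorNorm`). Compare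
`PastenShimura2024_cor_10_2.exists_datum_maninConstant_le_of_isSemistable`, the same from Pasten's
Cor. 10.2. [cite: Cesnavicius2018, Thm. 1.2] [cite: PastenShimura2024, §3 p. 13] -/
theorem exists_datum_maninConstant_le_of_isSemistable_of_abs_maninConstant_eq_one
    (hC1 : ∀ {N : ℕ} [NeZero N] {W : WeierstrassCurve ℚ} (D : ModularParametrizationData W N),
      D.abs_maninConstant_eq_one_of_isSemistable)
    (hopt : exists_optimal_modularParametrizationData)
    (hMK : mazurKenku_exists_cyclic_isogeny) (hNS : integral_neronScaling_of_isGloballyMinimal) :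
    ∃ M : ℕ, ∀ (W : WeierstrassCurve ℚ) [W.IsElliptic] [W.IsGloballyMinimal]
      [NeZero (W.conductorNorm ℤ)], W.IsSemistable ℤ →
        ∃ D : ModularParametrizationData W (W.conductorNorm ℤ), D.maninConstant.natAbs ≤ M := by
  obtain ⟨M, hM⟩ := exists_datum_maninConstant_le_of_row ∅
    (PastenShimura2024_cor_10_2_row_empty_of_abs_maninConstant_eq_one_of_isSemistable hC1)
    hopt hMK hNS
  refine ⟨M, fun W _ _ _ hss ↦ hM W (W.conductorNorm ℤ) rfl fun p hp _ ↦ ?_⟩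
  exact squarefree_iff_forall_prime_not_sq_dvd.mp
    ((W.isSemistable_iff_squarefree_conductorNorm).mp hss) p hp

end Downstream

/-! ### Row by row: the row at `S` is Thm. 10.1 at the primes of `S ∪ {2}`, modulo Mazur -/

section RowByRow

/-- **Each row of Cor. 10.2 is equivalent to its lattice (printed-optimality) form** — the
row-wise form of `PastenShimura2024_cor_10_2_iff_latticeForm`: a datum of minimal degree among
all data with its newform is lattice-optimal (`exists_optimalDatum'`, `latticeEq_of_modularDegree_le`)
and a lattice-optimal datum has minimal degree (`forall_modularDegree_le_of_latticeEq`; Knapp 1993,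
Prop. 12.9 (a)). [cite: PastenShimura2024, Cor. 10.2 p. 33] [cite: Knapp1993, Prop. 12.9(a)] -/
theorem PastenShimura2024_cor_10_2_row_iff_latticeRow (S : Finset ℕ) :
    (∃ 𝓜 : ℕ, ∀ (N : ℕ) [NeZero N] (W : WeierstrassCurve ℚ) [W.IsElliptic]
      [W.IsGloballyMinimal] (Dt : ModularParametrizationData W N),
      (∀ p : ℕ, p.Prime → p ∉ S → ¬ p ^ 2 ∣ N) →
      (∀ (W' : WeierstrassCurve ℚ) [W'.IsElliptic] (D' : ModularParametrizationData W' N),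
          D'.f = Dt.f → Dt.modularDegree ≤ D'.modularDegree) →
        |Dt.maninConstant| ≤ 𝓜) ↔
    ∃ 𝓜 : ℕ, ∀ (W' : WeierstrassCurve ℚ) [W'.IsElliptic] [W'.IsGloballyMinimal]
      {N' : ℕ} [NeZero N'] (D' : ModularParametrizationData W' N'),
      (∀ z ∈ D'.L.lattice, ∃ w ∈ periodLattice D'.f, z = D'.c * w) →
      (∀ p : ℕ, p.Prime → p ∉ S → ¬ p ^ 2 ∣ N') → |D'.maninConstant| ≤ 𝓜 := by
  refine ⟨fun ⟨𝓜, h𝓜⟩ ↦ ⟨𝓜, fun W' _ _ N' _ D' hlat hsq ↦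
    h𝓜 N' W' D' hsq (D'.forall_modularDegree_le_of_latticeEq hlat)⟩, fun ⟨𝓜, h𝓜⟩ ↦ ?_⟩
  refine ⟨𝓜, fun N _ W _ _ Dt hsq hmin ↦ ?_⟩
  obtain ⟨W₀, hW₀, D₀, hf₀, h₀⟩ := Dt.exists_optimalDatum'
  haveI := hW₀
  exact h𝓜 W Dt (Dt.latticeEq_of_modularDegree_le D₀ hf₀ h₀ (hmin W₀ D₀ hf₀)) hsq

/-- **The row at `S` from Thm. 10.1 at the primes of `S ∪ {2}` and Mazur's Cor. 4.1** — the printed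
deduction (p. 33) one row at a time. Inputs: (`h101`) for each prime `p ∈ S ∪ {2}` a uniform bound
`v_p(c) ≤ μ_p` over the lattice-optimal data `D'` on globally minimal curves at levels square-free
away from `S` (Pasten's Thm. 10.1 at `(S, p)`; at `p = 2 ∉ S` this is classical — Abbes–Ullmo and
Česnavičius — but is kept as part of the hypothesis, as in
`PastenShimura2024_cor_10_2_of_thm_10_1_of_mazur`); (`hM`) Mazur 1978, Cor. 4.1 (`p` odd,
`p² ∤ N' ⇒ p ∤ c`). Then `|c| ≤ ∏_{p ∈ S ∪ {2} prime} p^{μ_p}`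
(`abs_le_prod_pow_of_padicValInt_le`: the primes outside `S ∪ {2}` are odd with `p² ∤ N'`), which is
the lattice row, hence the row (`PastenShimura2024_cor_10_2_row_iff_latticeRow`).
[cite: PastenShimura2024, Thm. 10.1 and Cor. 10.2 p. 33] [cite: Mazur1978, Cor. 4.1] -/
theorem PastenShimura2024_cor_10_2_row_of_thm_10_1_at_of_mazur (S : Finset ℕ)
    (h101 : ∀ p ∈ insert 2 S, p.Prime → ∃ μ : ℕ,
      ∀ (W' : WeierstrassCurve ℚ) [W'.IsElliptic] [W'.IsGloballyMinimal] {N' : ℕ} [NeZero N']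
        (D' : ModularParametrizationData W' N'),
        (∀ z ∈ D'.L.lattice, ∃ w ∈ periodLattice D'.f, z = D'.c * w) →
        (∀ q : ℕ, q.Prime → q ∉ S → ¬ q ^ 2 ∣ N') →
        padicValInt p D'.maninConstant ≤ μ)
    (hM : mazur_not_dvd_maninConstant_of_odd) :
    ∃ 𝓜 : ℕ, ∀ (N : ℕ) [NeZero N] (W : WeierstrassCurve ℚ) [W.IsElliptic]
      [W.IsGloballyMinimal] (Dt : ModularParametrizationData W N),
      (∀ p : ℕ, p.Prime → p ∉ S → ¬ p ^ 2 ∣ N) →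
      (∀ (W' : WeierstrassCurve ℚ) [W'.IsElliptic] (D' : ModularParametrizationData W' N),
          D'.f = Dt.f → Dt.modularDegree ≤ D'.modularDegree) →
        |Dt.maninConstant| ≤ 𝓜 := by
  classical
  refine (PastenShimura2024_cor_10_2_row_iff_latticeRow S).mpr ?_
  choose! μ hμ using h101
  refine ⟨∏ p ∈ (insert 2 S).filter Nat.Prime, p ^ μ p, fun W' _ _ N' _ D' hlat hsq ↦ ?_⟩
  refine abs_le_prod_pow_of_padicValInt_le D'.maninConstant_ne_zero_holds
    (fun p hp ↦ (Finset.mem_filter.mp hp).2) μ (fun p hp ↦ ?_) (fun p hp hpT ↦ ?_)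
  · -- `p ∈ S ∪ {2}` prime: Thm. 10.1 at `(S, p)`
    obtain ⟨hpS, hpp⟩ := Finset.mem_filter.mp hp
    exact hμ p hpS hpp W' D' hlat hsq
  · -- `p ∉ S ∪ {2}` prime: `p` is odd and `p² ∤ N'`, so `p ∤ c` by Mazur
    have hpT' : p ∉ insert 2 S := fun h ↦ hpT (Finset.mem_filter.mpr ⟨h, hp⟩)
    have hp2 : p ≠ 2 := fun h ↦ hpT' (h ▸ Finset.mem_insert_self 2 S)
    have hpS : p ∉ S := fun h ↦ hpT' (Finset.mem_insert_of_mem h)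
    exact hM W' D' hlat p hp hp2 (hsq p hp hpS)

/-- **Conversely, the row at `S` gives Thm. 10.1 at `S` for EVERY prime** (with `μ = 𝓜_S`
uniform in `p`): for a lattice-optimal datum at a level square-free away from `S`,
`v_p(c) ≤ |c| ≤ 𝓜_S` (`padicValInt_le_natAbs`; a lattice-optimal datum has minimal degree,
`forall_modularDegree_le_of_latticeEq`). Row-wise form of
`PastenShimura2024_thm_10_1_latticeForm_of_cor_10_2`. [cite: PastenShimura2024, Thm. 10.1 and Cor. 10.2 p. 33] -/
theorem PastenShimura2024_cor_10_2_thm_10_1_at_of_row (S : Finset ℕ)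
    (hrow : ∃ 𝓜 : ℕ, ∀ (N : ℕ) [NeZero N] (W : WeierstrassCurve ℚ) [W.IsElliptic]
      [W.IsGloballyMinimal] (Dt : ModularParametrizationData W N),
      (∀ p : ℕ, p.Prime → p ∉ S → ¬ p ^ 2 ∣ N) →
      (∀ (W' : WeierstrassCurve ℚ) [W'.IsElliptic] (D' : ModularParametrizationData W' N),
          D'.f = Dt.f → Dt.modularDegree ≤ D'.modularDegree) →
        |Dt.maninConstant| ≤ 𝓜)
    (p : ℕ) (hp : p.Prime) :
    ∃ μ : ℕ, ∀ (W' : WeierstrassCurve ℚ) [W'.IsElliptic] [W'.IsGloballyMinimal] {N' : ℕ} [NeZero N']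
      (D' : ModularParametrizationData W' N'),
      (∀ z ∈ D'.L.lattice, ∃ w ∈ periodLattice D'.f, z = D'.c * w) →
      (∀ q : ℕ, q.Prime → q ∉ S → ¬ q ^ 2 ∣ N') →
      padicValInt p D'.maninConstant ≤ μ := by
  obtain ⟨𝓜, h𝓜⟩ := (PastenShimura2024_cor_10_2_row_iff_latticeRow S).mp hrow
  refine ⟨𝓜, fun W' _ _ N' _ D' hlat hsq ↦ ?_⟩
  have h1 : (padicValInt p D'.maninConstant : ℤ) ≤ (D'.maninConstant.natAbs : ℤ) := by
    exact_mod_cast padicValInt_le_natAbs D'.maninConstant_ne_zero_holds hp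
  rw [Int.natCast_natAbs] at h1
  exact_mod_cast h1.trans (h𝓜 W' D' hlat hsq)

/-- **Modulo Mazur's Cor. 4.1, the row of Cor. 10.2 at `S` is equivalent to Pasten's Thm. 10.1 at
the primes of `S ∪ {2}`** (lattice form, levels square-free away from `S`):
`PastenShimura2024_cor_10_2_row_of_thm_10_1_at_of_mazur` and
`PastenShimura2024_cor_10_2_thm_10_1_at_of_row`. The row-wise sharpening of
`PastenShimura2024_cor_10_2_iff_thm_10_1_latticeForm_of_mazur`: a consumer of ONE row depends on
Pasten's theorem at finitely many primes only. [cite: PastenShimura2024, Thm. 10.1 and Cor. 10.2 p. 33]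
[cite: Mazur1978, Cor. 4.1] -/
theorem PastenShimura2024_cor_10_2_row_iff_thm_10_1_at_of_mazur
    (hM : mazur_not_dvd_maninConstant_of_odd) (S : Finset ℕ) :
    (∃ 𝓜 : ℕ, ∀ (N : ℕ) [NeZero N] (W : WeierstrassCurve ℚ) [W.IsElliptic]
      [W.IsGloballyMinimal] (Dt : ModularParametrizationData W N),
      (∀ p : ℕ, p.Prime → p ∉ S → ¬ p ^ 2 ∣ N) →
      (∀ (W' : WeierstrassCurve ℚ) [W'.IsElliptic] (D' : ModularParametrizationData W' N),
          D'.f = Dt.f → Dt.modularDegree ≤ D'.modularDegree) →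
        |Dt.maninConstant| ≤ 𝓜) ↔
    ∀ p ∈ insert 2 S, p.Prime → ∃ μ : ℕ,
      ∀ (W' : WeierstrassCurve ℚ) [W'.IsElliptic] [W'.IsGloballyMinimal] {N' : ℕ} [NeZero N']
        (D' : ModularParametrizationData W' N'),
        (∀ z ∈ D'.L.lattice, ∃ w ∈ periodLattice D'.f, z = D'.c * w) →
        (∀ q : ℕ, q.Prime → q ∉ S → ¬ q ^ 2 ∣ N') →
        padicValInt p D'.maninConstant ≤ μ :=
  ⟨fun hrow p _ hp ↦ PastenShimura2024_cor_10_2_thm_10_1_at_of_row S hrow p hp,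
    fun h101 ↦ PastenShimura2024_cor_10_2_row_of_thm_10_1_at_of_mazur S h101 hM⟩

/-- **The row `S = {2}` — the hypothesis `hManin {2}` of the `abc` routes' Ribet–Takahashi
packages on the printed family (semistable away from `2`, e.g. every Frey–Hellegouarch curve) —
is, modulo Mazur's Cor. 4.1, EXACTLY the case `p = 2` of Pasten's Thm. 10.1 at `S = {2}`**: a
uniform bound for `v₂(c)` over the lattice-optimal data on globally minimal curves at levels `N'`
with `q² ∤ N'` for every odd prime `q` (the optimal curves semistable away from `2`, `v₂(N') ≤ 8`).
This is the paper's genuinely new content at one prime (Thm. 10.3 at `p = 2`, `2 ≤ n ≤ 8`, pp.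
33–37); the results at `v₂(N) ≤ 1` (Abbes–Ullmo, Česnavičius) do not bound `v₂(c)` when `4 ∣ N'`.
[cite: PastenShimura2024, Thm. 1.3 p. 4, Thm. 10.1 and Cor. 10.2 p. 33] [cite: Mazur1978, Cor. 4.1] -/
theorem PastenShimura2024_cor_10_2_row_two_iff_of_mazur (hM : mazur_not_dvd_maninConstant_of_odd) :
    (∃ 𝓜 : ℕ, ∀ (N : ℕ) [NeZero N] (W : WeierstrassCurve ℚ) [W.IsElliptic]
      [W.IsGloballyMinimal] (Dt : ModularParametrizationData W N),
      (∀ p : ℕ, p.Prime → p ∉ ({2} : Finset ℕ) → ¬ p ^ 2 ∣ N) →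
      (∀ (W' : WeierstrassCurve ℚ) [W'.IsElliptic] (D' : ModularParametrizationData W' N),
          D'.f = Dt.f → Dt.modularDegree ≤ D'.modularDegree) →
        |Dt.maninConstant| ≤ 𝓜) ↔
    ∃ μ : ℕ, ∀ (W' : WeierstrassCurve ℚ) [W'.IsElliptic] [W'.IsGloballyMinimal] {N' : ℕ} [NeZero N']
      (D' : ModularParametrizationData W' N'),
      (∀ z ∈ D'.L.lattice, ∃ w ∈ periodLattice D'.f, z = D'.c * w) →
      (∀ q : ℕ, q.Prime → q ∉ ({2} : Finset ℕ) → ¬ q ^ 2 ∣ N') →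
      padicValInt 2 D'.maninConstant ≤ μ := by
  rw [PastenShimura2024_cor_10_2_row_iff_thm_10_1_at_of_mazur hM {2}]
  refine ⟨fun h ↦ h 2 (Finset.mem_insert_self 2 _) Nat.prime_two, fun h p hp _ ↦ ?_⟩
  rw [Finset.insert_eq_of_mem (Finset.mem_singleton_self 2), Finset.mem_singleton] at hp
  subst hp
  exact h

/-- **Hence the fact's use in the `abc` routes, isolated**: Mazur's Cor. 4.1 and the single
`p = 2` case of Pasten's Thm. 10.1 at `S = {2}` give the row `S = {2}` of Cor. 10.2, i.e. the
bound `|c| ≤ 𝓜_{{2}}` for every minimal-degree datum on a globally minimal curve at a level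
square-free away from `2` — everything `jlPackage_printedClass_of_facts` / `stub_twoPrimePackage`
take from `PastenShimura2024_cor_10_2`. [cite: PastenShimura2024, Thm. 10.1 and Cor. 10.2 p. 33]
[cite: Mazur1978, Cor. 4.1] -/
theorem PastenShimura2024_cor_10_2_row_two_of_thm_10_1_two_of_mazur
    (h2 : ∃ μ : ℕ, ∀ (W' : WeierstrassCurve ℚ) [W'.IsElliptic] [W'.IsGloballyMinimal] {N' : ℕ}
      [NeZero N'] (D' : ModularParametrizationData W' N'),
      (∀ z ∈ D'.L.lattice, ∃ w ∈ periodLattice D'.f, z = D'.c * w) →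
      (∀ q : ℕ, q.Prime → q ∉ ({2} : Finset ℕ) → ¬ q ^ 2 ∣ N') →
      padicValInt 2 D'.maninConstant ≤ μ)
    (hM : mazur_not_dvd_maninConstant_of_odd) :
    ∃ 𝓜 : ℕ, ∀ (N : ℕ) [NeZero N] (W : WeierstrassCurve ℚ) [W.IsElliptic]
      [W.IsGloballyMinimal] (Dt : ModularParametrizationData W N),
      (∀ p : ℕ, p.Prime → p ∉ ({2} : Finset ℕ) → ¬ p ^ 2 ∣ N) →
      (∀ (W' : WeierstrassCurve ℚ) [W'.IsElliptic] (D' : ModularParametrizationData W' N),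
          D'.f = Dt.f → Dt.modularDegree ≤ D'.modularDegree) →
        |Dt.maninConstant| ≤ 𝓜 :=
  (PastenShimura2024_cor_10_2_row_two_iff_of_mazur hM).mpr h2

end RowByRow

end Literature.NumberTheory.Automorphic

end
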